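import Mathlib
import HarnessLib
import HarnessLib.Audit
import Summits.HodgeConjecture.Statement
import Literature.AlgebraicGeometry.HodgeTheory.AbsoluteHodgeClasses
import Literature.AlgebraicGeometry.HodgeTheory.GysinFormalism
import Literature.AlgebraicGeometry.Motives.FamiliesVHS
import Literature.AlgebraicGeometry.Motives.BaseChange
import HarnessLib.Audit.Status.Attr

/-!
Route: TateCuspKLift

DORMANT since 2026-08-26T16:57:53Z (reconciler: no traction for 5.4 d (last activity item-evidence-added at 2026-08-21T05:52:00Z); parked, not closed — `ledger route dormant route-HodgeConjecture-TateCuspKLift --off` to reactivate) — unstaffed, not closed; items shared with open routes are served there. `ledger route dormant <id> --off` reactivates.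

# Route TateCuspKLift — Hodge theory has no Ext², motives do: at a ℚ̄-Tate cusp the limit of an
absolute Hodge class is a K-class for free (Ext² of mixed Tate motives over a number field vanishes,
Borel); deform it sideways

It suffices to show X = CuspAccessibleHodge (realises card ext2-milnor-flux-arithmetic-cusps,
proving direction: its theorem-candidate (G) + its hand-over step E4, typed on the tree's real
carriers): THE HODGE CONJECTURE HOLDS FOR CUSP-ACCESSIBLE ABSOLUTE HODGE CLASSES. Data: a smooth
projective 𝒳/ℂ of dimension N, a smooth projective curve C, a morphism f : 𝒳 → C and a point o ∈
C(ℂ) whose scheme-theoretic fibre X_o = f⁻¹(o) is ℚ̄-TATE — isomorphic over ℂ to the base change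
along some σ : ℚ̄ → ℂ of a ℚ̄-scheme admitting a finite partition into locally closed split tori
𝔾_m^b (affine pavings qualify since 𝔸^a is stratified by tori; so do snc unions of toric varieties
glued along torus-invariant strata, e.g. the fibre at a 0-dimensional toroidal cusp of a
Shimura-type Hodge locus). Claim: for every ABSOLUTE HODGE class ξ ∈ H^(2p)(𝒳(ℂ);ℂ) and every smooth
projective fibre X_t, the restriction ξ|X_t is algebraic (lies in algebraicClasses X_t p). In words:
a flat family of Hodge classes over a curve of its Hodge locus that reaches a ℚ̄-Tate cusp and
extends to an absolute Hodge class on the semistable total space (automatic for motivated classes by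
André's deformation principle, hence for all Hodge classes on abelian varieties) consists of
algebraic classes. X = K1 then K2: K1 = ArithmeticTateRestriction (ξ|X_o is a Chern character of
K₀(X_o)⊗ℚ, rendered as membership in the span PB^p(X_o) of pulled-back algebraic classes — the
card's (G)), K2 = KClassPropagates (a K-theoretic limit propagates to the smooth fibres — the card's
E4); the engine composition EngineGlue := K1 → K2 → X is proved in the planner's Sketch.lean, and
the deciding theorem `closes` (D-0027 §2.1) is X + the summit frame Assembly := X → HodgeConjecture
(scope complement, see § Assembly). This is the conforming re-open of route MilnorFluxCusps (same
card, same typed items), retired `not-a-thesis` by the 2026-08-15 D-0027 audit because its assembly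
stopped at X.
Lean: `∀ (N p : ℕ) (𝒳 C : Literature.AlgebraicGeometry.Motives.SchemeOver ℂ) (f : 𝒳 ⟶ C) (o :
Literature.AlgebraicGeometry.Motives.AlgPoints C ℂ),
Literature.AlgebraicGeometry.Motives.IsSmoothProjective N 𝒳 →
Literature.AlgebraicGeometry.Motives.IsSmoothProjective 1 C → (∃ (X₁ :
Literature.AlgebraicGeometry.Motives.SchemeOver (AlgebraicClosure ℚ)) (σ : AlgebraicClosure ℚ →+* ℂ)
(_ : Literature.AlgebraicGeometry.Motives.fiberOver f o ≅
(Literature.AlgebraicGeometry.Motives.baseChangeHom σ).obj X₁) (ι : Type) (_ : Finite ι) (b : ι → ℕ)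
(e : ∀ i : ι, Literature.AlgebraicGeometry.Motives.specOver (AlgebraicClosure ℚ) (AddMonoidAlgebra
(AlgebraicClosure ℚ) (Fin (b i) →₀ ℤ)) ⟶ X₁), (∀ i, AlgebraicGeometry.IsImmersion (e i).left) ∧
(Pairwise fun i j => Disjoint (Set.range fun x => (e i).left.base x) (Set.range fun x => (e
j).left.base x)) ∧ (⋃ i, Set.range fun x => (e i).left.base x) = Set.univ) → ∀ ξ :
Literature.AlgebraicGeometry.HodgeTheory.complexBetti 𝒳 (2 * p),
Literature.AlgebraicGeometry.HodgeTheory.IsAbsoluteHodgeClass N 𝒳 p ξ → ∀ (t :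
Literature.AlgebraicGeometry.Motives.AlgPoints C ℂ) (n : ℕ),
Literature.AlgebraicGeometry.Motives.IsSmoothProjective n
(Literature.AlgebraicGeometry.Motives.fiberOver f t) →
(Literature.AlgebraicGeometry.HodgeTheory.complexBetti.map
(Literature.AlgebraicGeometry.Motives.fiberι f t) (2 * p)).hom ξ ∈
Literature.AlgebraicGeometry.HodgeTheory.algebraicClasses
(Literature.AlgebraicGeometry.Motives.fiberOver f t) p`

## Assembly
DECIDING THEOREM (D-0027 §2.1, glue.lean, elaborates with the file and is proved in Sketch.lean):
`theorem closes (h₀ : CuspAccessibleHodge) (h₁ : Assembly) (h₂ : ArithmeticTateRestriction) (h₃ :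
KClassPropagates) (h₄ : VariationalHodgeOverCurves) (h₅ : EngineGlue) : _root_.HodgeConjecture := h₁
(h₅ h₂ h₃)` — the cruxes K1, K2 compose to X by EngineGlue (pure logic), and the summit frame
Assembly := X → HodgeConjecture carries X to the Statement. HONEST STATUS of the frame: it is the
COMPLEMENT of the route's scope — the Hodge conjecture for classes that are not cusp-accessible (no
curve of their Hodge locus reaches a ℚ̄-Tate cusp with an absolute Hodge extension on the total
space: rigid classes, non-hyperbolic Weil components, …) — it is implied by HodgeConjecture itself,
is NOT claimed by this line, and is expected to close only through other routes
(FiniteTreeOfFlavours / QbarEnvelope for rigid classes, TropicalCuspLift's Witt tower for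
non-hyperbolic Weil components); it is filed because every route must literally decide the
sub-problem and so that the exact remainder of this line is one explicit statement on the ledger
(same device as TropicalCuspLift.Assembly). The Weil application inside the scope is the informal
crux HyperbolicWeilCusps filed right after open: for every abelian 2n-fold of Weil type on a
HYPERBOLIC component (disc H = (−1)^n mod Nm K*, equivalently a 0-dimensional toroidal cusp exists)
and every Weil class w it supplies a datum of X — a ℚ̄-curve through a 0-dimensional cusp of the
Weil locus, its semistable projective model 𝒳 → C with torus-partitioned snc fibre (Mumford /
FaltingsChai1990), and a motivated (hence absolute Hodge) extension ξ of the Weil plane with ξ|X_t₁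
= w (Andre1996Motifs Thm 0.5 + Deligne1982HodgeCycles) — so X ⟹ Weil classes algebraic on hyperbolic
components for all n ≥ 2 (open for n ≥ 4).

Rationale: WHY THIS LINE. Mixed Hodge structures have no Ext², motives over ℂ do, and the card reads the
obstruction to a LIMIT Hodge class being motivic on the snc fibre X₀ = ∪X_i of a semistable
degeneration off the closed-cover/cdh descent spectral sequence E₁^(a,b) = CH^p(X^[a], 2p−b)_ℚ ⇒
H^(2p)_M(X₀, ℚ(p)): Bloch's exotic class (Bloch1990LetterJannsen; Arapura2016SingularLefschetz Ex.
8.2) is the d₁/Abel–Jacobi-kernel species, behind it sit the regulator-invisible species d₂ ∈ K₁ and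
d₃ ∈ K₂(ℂ) ⊗ H³(dual complex) ('Milnor flux': Steinberg symbols of the gluing parameters,
Milnor1972) and d₄ ∈ K₃^ind(ℂ) ⊗ H⁴(Γ). Where X₀ together with its Tate stratification is defined
over a number field F all of it dies: M(X₀) ∈ DMT(F) carries Levine's motivic t-structure,
Ext²_MT(F) = 0 and Ext¹_MT(F)(ℚ(0), ℚ(j)) = K_(2j−1)(F)_ℚ with K_(2j−2)(F) ⊗ ℚ = 0
(DeligneGoncharov2005 §§1–2, Borel1977), so H^(2p)_M(X₀, ℚ(p)) ↠ Hom_MT(ℚ(−p), h^(2p)(X₀)) and the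
one remaining Ext¹ lift-obstruction is detected by the Hodge realisation at ALL complex places
(Borel's regulator injectivity; units inject at a single place) — exactly what an ABSOLUTE Hodge
class on the total space supplies (Deligne1982HodgeCycles for abelian varieties; Andre1996Motifs Thm
0.5 extends a motivated flat section to a motivated class on the compactified family). Hence at
arithmetic cusps the anchor every cusp programme needs — a K-class on the toric fibre whose Chern
character is the limit Hodge class (the input of TropicalCuspLift's DepthOneLogLift;
Kontsevich–Zharkov's tropical test Zharkov2020TropicalWeil run in reverse) — is FREE and
unconditional (Arapura's Conj. 8.1, conditional on HC + Bloch–Beilinson and depth ≤ 2 in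
Arapura2016SingularLefschetz Prop. 8.3, becomes a short argument for mixed Tate X₀), and the whole
difficulty is concentrated in ONE sideways step: deform the K₀(X₀)-class off the snc fibre along the
Hodge locus and algebraize (log form of BlochEsnaultKerz2014CharZero; FaltingsChai1990 for the
toroidal models). Imported areas: mixed Tate motives and K-theory of number fields
(DeligneGoncharov2005, Borel1977, Milnor1972), cdh-descent / homotopy K-theory of singular varieties
(Arapura2016SingularLefschetz §§6–8, Totaro2014ChowLinear §8, Anderson–Payne arXiv:1301.0425),
toroidal degenerations of abelian varieties (FaltingsChai1990), absolute Hodge and motivated classes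
(Deligne1982HodgeCycles, Andre1996Motifs, CharlesSchnell2014Notes). Two rendering devices make it
typable on real carriers (the tree has no algebraic K-theory and no mixed Hodge structures):
'ch_p-image of K₀(X₀) ⊗ ℚ' = PB^p(X₀), the ℂ-span of pull-backs g^*a of algebraic classes a along
all morphisms g : X₀ → Y to smooth projective Y (equal to it by Grassmannians +
Grothendieck–Riemann–Roch; Arapura Lemma 8.6 is one inclusion into im H_M), and 'weight-2p Hodge
cycle on X₀' = restriction of a Hodge class of the smooth projective total space (image of a pure
weight-2p structure, so a genuine Hom_MHS(ℚ(−p), H^(2p)(X₀)) element — never one of the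
W_(2p−1)-phantoms that the barrier file's IsHodgeOnSmoothPullbacks admits). What prior routes do not
do: TropicalCuspLift lifts semiregular OBJECTS through depth-1 cusps by induction from Markman's
fourfolds and must BUILD its cycle on the toric fibre (tropical HC); QbarEnvelope and
AnchorTransport anchor at interior ℚ̄-points (KOU, André); LimitExtension and SecondaryPeriods never
leave (limit) mixed Hodge theory = Ext¹; none uses the K-theory of the degenerate fibre or the
vanishing of Ext² over number fields.

RANKED CRUXES. #0 CuspAccessibleHodge (target) — X as in the Thesis: smooth projective 𝒳 → C over a
smooth projective curve, o ∈ C(ℂ) with ℚ̄-Tate fibre X_o (base change of a ℚ̄-scheme partitioned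
into finitely many locally closed split tori), ξ ∈ H^(2p)(𝒳(ℂ);ℂ) absolute Hodge ⟹ ξ|X_t ∈
algebraicClasses X_t p for every smooth projective fibre X_t. (why it might fail: Implied by HC
(HC-safe). Non-vacuous only where ℚ̄-Tate cusps exist: for Weil type exactly the HYPERBOLIC
components (disc = (-1)^n mod Nm K*), so the n = 3 non-hyperbolic frontier is not served; first open
cases n >= 4; needs absolute Hodge extension on the total space.) [Arapura2016SingularLefschetz,
DeligneGoncharov2005, FaltingsChai1990, Andre1996Motifs, Markman2025SecantWeil,
vanGeemen1994HodgeAV]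
#2 ArithmeticTateRestriction (crux) — (card (G)/(M3) and E0 — the arithmetic-cusp theorem-candidate,
typed.) For 𝒳, C, f, o as in X with X_o ℚ̄-Tate and ξ ∈ H^(2p)(𝒳(ℂ);ℂ) absolute Hodge, ξ|X_o lies in
PB^p(X_o) := ℂ-span of {g^*a : g : X_o → Y a ℂ-morphism, Y smooth projective, a ∈ algebraicClasses Y
p} ( = ch_p(K₀(X_o) ⊗ ℚ) ⊗ ℂ: every vector bundle is a Grassmannian pull-back after an ample twist,
and conversely g^*cl(Z) = ch_p(g^*u) with u = ch⁻¹[Z] ∈ K₀(Y)_ℚ by GRR, ch(u) concentrated in degree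
p; a rational class in the ℂ-span of rational vectors lies in their ℚ-span). Intended proof: ξ|X_o ∈
Hom_MHS(ℚ(−p), H^(2p)(X_o)) (image of a pure weight-2p structure); X_o ≅ X₁ ⊗_σ ℂ with X₁
torus-partitioned over ℚ̄, hence over a number field F, so M(X₁) ∈ DMT(F); Ext²_MT(F) = 0 gives
H^(2p)_M(X₁, ℚ(p)) ↠ Hom_MT(F)(ℚ(−p), h^(2p)(X₁)); Gr^W_(2p)(ξ|X_o) is a ℚ-combination of cycle
classes of strata, canonically defined over F, and the Ext¹_MT-obstruction to lifting it into W_(2p)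
has vanishing Hodge realisation at EVERY complex place τ = σ'σ because the conjugate ξ^σ' is again a
Hodge class restricting to X_o^σ' (absolute Hodge) — Borel injectivity on ⊕_τ for K_(2j−1)(F)_ℚ, j ≥
2, units at j = 1, dévissage along the weight filtration — so a motivic lift exists; by strictness
its realisation IS ξ|X_o; finally H^(2p)_M = KH₀(X_o)^(p)_ℚ (cdh descent) and the class must be
reached from honest K₀(X_o) ⊗ ℚ (the K₀-vs-KH₀ step, see why it might fail). General form (not
typed): the same for g^*ξ along any morphism g from a quasi-projective ℚ̄-Tate X₀. [difficulty: XL]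
(why it might fail: (G) lands in cdh-motivic H^{2p}_M = KH_0^{(p)}; the typed conclusion is honest
K_0 (PB = Chern characters of vector bundles). K_0 -> KH_0 can miss Hodge cycles (BVS cuspidal
surface, p = 1: in H^2_M, not in Pic); for snc unions of toric varieties K_0-regularity in Adams
degree p is unproved.) [Arapura2016SingularLefschetz, DeligneGoncharov2005, Borel1977,
Bloch1990LetterJannsen, Deligne1982HodgeCycles, Totaro2014ChowLinear, arXiv:1301.0425,
arXiv:1907.00076]
#3 KClassPropagates (crux) — (card E4, the sideways step; ANY fibre, no arithmetic.) For f : 𝒳 → C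
as above and ξ ∈ H^(2p)(𝒳(ℂ);ℂ) rational of Hodge type (p,p): if ξ|X_o ∈ PB^p(X_o) — i.e. ξ|X_o =
ch_p(v) for some v ∈ K₀(X_o) ⊗ ℚ with ch(v) concentrated in degree p — then ξ|X_t is algebraic on
every smooth projective fibre X_t. Mechanism: represent v by perfect complexes on X_o, deform over
the formal/log germ of C at o (log Bloch–Esnault–Kerz: the obstruction is the Hodge obstruction,
which vanishes because ξ is globally of type (p,p)), algebraize (𝒳 is projective over C), read off
ch_p = ξ|X_t for t near o, spread along C (countably many relative Chow components, one dominates).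
Contains Grothendieck's variational Hodge conjecture over curves (support VariationalHodgeOverCurves
= the case X_o smooth; KClassPropagates → it is proved in Sketch.lean). [deps:
ArithmeticTateRestriction] [difficulty: open-problem] (why it might fail: Contains Grothendieck's
variational HC (X_o smooth). Mechanism: log-BEK formal lifting of perfect complexes on an snc fibre
is unproved; algebraization of formal K-classes fails in general (BEK); a K_0-class without
semiregular representative may be obstructed. Typed form fails only with HC.)
[BlochEsnaultKerz2014CharZero, Bloch1972Semiregularity, BuchweitzFlenner2003, arXiv:2604.00511,
Steenbrink1976]
#9 VariationalHodgeOverCurves (support) — the smooth-special-fibre case of KClassPropagates =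
Grothendieck's variational Hodge conjecture in global-class form over a projective curve: ξ rational
of type (p,p) on a smooth projective 𝒳 → C, ξ|X_o algebraic on ONE smooth projective fibre X_o ⟹
ξ|X_t algebraic on every smooth projective fibre. Filed to make the containment explicit
(KClassPropagates → VariationalHodgeOverCurves, three lines in Sketch.lean: an algebraic class on a
smooth projective fibre is a pulled-back algebraic class along the identity) and as the meeting
point with route AnchorTransport's VariationalHodge (smooth families over an arbitrary smooth base,
total space not compactified). Open problem in general (known for p = 1 and in BEK's formal form).
[difficulty: open-problem] [BlochEsnaultKerz2014CharZero, Bloch1972Semiregularity]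
#9 EngineGlue (support) — the engine composes by pure logic: ArithmeticTateRestriction →
KClassPropagates → CuspAccessibleHodge (an absolute Hodge class is rational and of type (p,p); K1
supplies the PB-membership that K2 consumes). Proved sorry-free in Sketch.lean (`engineGlue_holds`,
axioms propext / Classical.choice / Quot.sound); filed so that a prover can land it at once and the
route's internal logic is on the ledger. [difficulty: provable-now] [Arapura2016SingularLefschetz,
BlochEsnaultKerz2014CharZero]

TWO-LAYER PLAN. Foreseen glued splits (k ≤ 3, depth 1), none filed now because the tree lacks
K-theory and log structures: KClassPropagates ⇐ LogFormalKLift (pro-class on the formal completion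
of 𝒳 along X_o, log-BEK) → KAlgebraization (formal K-class ⟹ K-class over the henselised curve) →
KClassPropagates (spreading glue); ArithmeticTateRestriction ⇐ MotivicLift (ξ|X_o ∈ im H^(2p)_M, the
pure (G)) → SncToricKRegularity (K₀ ⊗ ℚ → KH₀ ⊗ ℚ onto Adams degree p for snc unions of smooth
projective toric varieties) → ArithmeticTateRestriction; HyperbolicWeilCusps ⇐ CuspModel (relatively
complete model over a ℚ̄-curve, smooth cone decomposition) → MotivatedExtension (André Thm 0.5 +
Deligne) → HyperbolicWeilCusps.

KILL CRITERIA. (i) The typed items are HC-safe: refuting CuspAccessibleHodge,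
ArithmeticTateRestriction or KClassPropagates as typed exhibits a counterexample to HC (route and
summit settle together; the negated decl is the certificate). Mechanism kills: (ii) a proof that
K₀(X_o) ⊗ ℚ → KH₀(X_o) ⊗ ℚ is NOT onto Adams degree p for the Mumford cusp fibres (snc unions of
smooth projective toric varieties) kills the proof (G) of K1 — pivot: restate K1 for a semistable
model after base change / perfect complexes, else close; (iii) a gap in 'absolute Hodge ⟹ Hodge
lifts at all places ⟹ Borel' (e.g. the Gr^W_(2p) component not canonically F-rational) sends K1 back
to single-place regulator injectivity, which is open — close unless W_(2p−4)H^(2p)(X_o) = 0 in the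
application (then only units occur and one place suffices: restate with that hypothesis); (iv) the
informal negative-side item MilnorFluxInhabited REFUTED (d₃, d₄ vanish on limits of Hodge classes
over ℂ) is not a kill but an upgrade: drop ℚ̄ from K1 (route edit --restate); (v) an obstructed
example for log-deformation of K-classes without semiregular representatives at an snc fibre inside
a Hodge locus kills K2's mechanism → close --reason superseded --by
route-HodgeConjecture-TropicalCuspLift (semiregular objects); (vi) TropicalCuspLift.WittTowerStep or
WeilConeBoundary.Target proved ⟹ the Weil application is moot; X survives only as a general engine
for other cusp-accessible loci; (vii) the frame Assembly can only be refuted together with HC.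

NOT DECOMPOSED YET. Filed INFORMAL right after open (signatures later): HyperbolicWeilCusps (crux,
rank 4; typing needs a hyperbolicity predicate bridging H¹(A(ℂ),ℚ) to Motives.WeilDiscriminant —
definition request), the negative side of the card — FluxWellDefined (support = E1: the flux of a
limit Hodge cycle is model-independent modulo the stated indeterminacy), MilnorFluxInhabited (crux,
rank 5 = E2: an snc ℂ-variety with toric strata and a limit Hodge cycle of nonzero K₂-flux; its
refutation upgrades K1 to ℂ), SteinbergSymbolMatrix (support = E3: the symbol matrix of Zharkov's
tropical Weil classes at a 2-parameter cusp, kit-sized) — and SncToricKRegularity (support).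
Deliberately not decomposed: the summit frame Assembly (scope complement — by design, see §
Assembly); non-hyperbolic Weil components (positive-dimensional cusps with CM abelian parts: (G)
there needs Beilinson's conjectures for the abelian part — conditional, a separate conditional
bridge if ever); the log-BEK / algebraization split of K2 and the K₀-vs-KH₀ split of K1 (Two-layer
plan); spreading from 'all fibres of one curve' to 'the whole Hodge-locus component' (Baire/CDK;
TropicalCuspLift.BaireSpreading) — not needed for X as typed.

CHEAPEST FALSIFIER. Both on the MECHANISM of K1 (the typed items cannot fail unless HC fails). (a)
Lookup: Anderson–Payne (arXiv:1301.0425 §1) ask whether K⁰(X) → opK⁰(X) is onto for complete toric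
X; the K₀-form of (G) asserts its rational cohomological shadow for every projective toric X/ℚ (each
weight-2p Hodge cycle of H^(2p)(X,ℚ) is a K₀ Chern character) (cf. arXiv:1907.00076, Gubeladze): one
projective toric threefold with a weight-4 Hodge cycle outside ch₂(K₀ ⊗ ℚ) kills the K₀-form of (G)
for toric (non-snc) fibres and throws K1 onto the snc/K-regularity bet. (b) Finite computation (the
card's calibration): at a ℚ̄ totally degenerate cusp of Weil-type abelian FOURFOLDS (p = 2, Γ = real
4-torus, H³(Γ) = ℚ⁴, H⁴(Γ) = ℚ) run the closed-cover descent spectral sequence for the Mumford fibre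
(smooth projective toric components, K_*(X_I) = K_*(ℚ̄) ⊗ K₀(X_I)) and decide whether K₀ ⊗ ℚ → KH₀ ⊗
ℚ is onto Adams degree 2; Markman's theorem + semistable reduction force the limit Weil classes into
ch₂(K₀ ⊗ ℚ) of SOME model, so failure on the minimal model isolates what (G) cannot deliver. lit
search unavailable (rc 75) all session: (a) NOT done — refuters first.

NUMBERS. Weil type (A, K = ℚ(√−d), h), dim A = 2n, signature (n,n), Weil plane of dimension 2;
hyperbolic ⟺ disc H = (−1)^n in ℚ*/Nm(K*) ⟺ Witt index n ⟺ a 0-dimensional (totally degenerate,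
torus rank 2n) cusp exists (vanGeemen1994HodgeAV 5.2–5.4; Markman2025SecantWeil §1.1;
TropicalCuspLift planner's dictionary); known: n = 2 all discriminants (Markman2025SecantWeil,
arXiv:2509.23079), n = 3 disc −1 = hyperbolic (arXiv:2502.03415); open: n = 3 non-hyperbolic, every
n ≥ 4. K-theory of a number field F with r₁ real and r₂ complex places: K_(2j−2)(F) ⊗ ℚ = 0 for j ≥
2, rank K_(2j−1)(F) = r₂ (j even), r₁ + r₂ (j odd ≥ 3), ⊕_places regulator injective ⊗ ℚ
(Borel1977); K₁(F) = F* (infinite rank, injective into ℂ* at one place). Mixed Tate motives over F: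
Ext^i_MT(F) = 0 for i ≥ 2, Ext¹(ℚ(0),ℚ(j)) = K_(2j−1)(F)_ℚ (DeligneGoncharov2005 §§1–2). At a
totally degenerate cusp of abelian 2n-folds: dual complex Γ ≃ (S¹)^(2n); for p = 2: H³(Γ) =
ℚ^C(2n,3) (K₂-flux species), H⁴(Γ) = ℚ^C(2n,4) (K₃^ind species).

DEFINITION REQUESTS. - HasSplitTorusPartition (Literature/AlgebraicGeometry/Motives): a k-scheme
admits a finite partition into locally closed subschemes isomorphic over k to split tori Spec k[ℤ^b]
(inlined verbatim in K1 and the Target), with the facts 'affinely paved ⟹ torus-partitioned' and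
'M(X) mixed Tate'.
- pulledBackAlgebraicClasses X p (Literature/AlgebraicGeometry/HodgeTheory): the ℂ-submodule PB^p(X)
of complexBetti X (2p) spanned by pull-backs of algebraicClasses Y p along morphisms X → Y, Y smooth
projective (inlined in K1, K2), with PB^p(X) = algebraicClasses X p for smooth projective X
(provable now: identity map one way, pull-back of supported classes the other) and the informal
dictionary PB = ch_p(K₀ ⊗ ℚ) ⊗ ℂ for quasi-projective X.
- IsHyperbolicWeilType (bridge Motives.AbelianVariety / HodgeTheory.WeilClasses.weilClassesOf ↔
Motives.WeilDiscriminant through the polarisation form on H¹(A(ℂ),ℚ)): needed to give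
HyperbolicWeilCusps a signature.
- cite facts wanted (family hodge): Ext^(≥2)_MT(F) = 0 and Ext¹ = K_(2j−1)(F)_ℚ for number fields
(DeligneGoncharov2005); Borel's regulator injectivity (Borel1977); André's deformation principle for
motivated classes and 'Hodge ⟹ motivated on abelian varieties' (Andre1996Motifs Thm 0.5, 0.6.2;
barrier decl Andre1996_hodgeClassesOnAbelianVarieties_motivated exists); Arapura's cycle map
H^(2p)_M → weight-2p Hodge cycles, Lemma 8.6 and Conj. 8.1 (Arapura2016SingularLefschetz); Deligne's
'Hodge classes on abelian varieties are absolute' (HodgeClassesAreAbsoluteFor, already in the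
barrier file).

Novelty: Searches (2026-08-15, this session): `lean search` for
Milnor|Steinberg|KTheory|K₀|MixedHodge|dualComplex|cdh|toric|cellular|paving (tree: no algebraic
K-theory, no MHS of singular varieties, no toric varieties; snc divisors exist in Resolution/),
`ledger idea list --problem HodgeConjecture` (115 cards; related and read:
tropical-cusp-log-semiregular-lift [route TropicalCuspLift], qbar-anchors-kou-andre-motivated
[QbarEnvelope], continuous-k-theory-algebraization, padic-semiregular-object-lifting
[PadicSemiregularLift], milnor-k-gerbe-exponential, liaison-limit-extension-ci-universality
[LimitExtension], secondary-periods-beilinson-bloch-test [SecondaryPeriods],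
motivated-anchor-transport [AnchorTransport]), route files TropicalCuspLift, WeilConeBoundary,
QbarEnvelope, LimitExtension, AnchorTransport, PeriodsPolice, FiniteTreeOfFlavours,
DegreeSpectroscopy read; `ledger negatives --problem HodgeConjecture` (0); `lit read
arXiv:1605.00587` pp. 17–18 (Conj. 8.1, Ex. 8.2, Prop. 8.3, Lemmas 8.4–8.7, Cor. 8.5/8.8/8.11
verbatim); `lit search` ('operational K-theory toric varieties Anderson Payne Kronecker duality
surjective'; 'K-regularity cdh-fibrant Hochschild homology normal crossing KH', --source local)
attempted 5×, searchd unavailable (rc 75) except once: 'Hodge conjecture singular varieties motivic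
cohomology defined over number field mixed Tate' (local 2 irrelevant; zbMATH/crossref 11: Jannsen
1994 'Motivic sheaves and filtrations on Chow groups', Raskind 2005 doi:10.1007/9  [refs: 10.1007/978-93-86279-23-1_7, 10.1007/978-3-322-85466-7_10, 1605.00587, 1301.0425, doi:10.1007/978-93-86279-23-1_7, doi:10.1007/978-3-322-85466-7_10, DeligneGoncharov2005]

Barriers (technique_class: motivic-ext2-flux, arithmetic-cusps, cdh-k-theory): - technique_class: motivic-ext2-flux, arithmetic-cusps, cdh-k-theory
-
Literature.Barriers.HodgeConjecture.Bloch1990_cohomologicalHodgeConjecture_singular_counterexample: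
not evaded — USED as the map of the obstruction. K1 asserts the K-theoretic singular Hodge statement
only for (a) restrictions of ambient absolute Hodge classes (genuine weight-2p Hodge cycles, never
the W_(2p−1)-phantoms that IsHodgeOnSmoothPullbacks admits, and implied by HC through PB ∋
restrictions of ambient algebraic classes) on (b) ℚ̄-mixed-Tate X₀, where Bloch's witness cannot
live (it needs a ℚ̄-generic point and h²_tr(S) ≠ 0, i.e. Ext² of a non-Tate motive over ℂ);
KTheoreticHodgeConjectureDegreeFour B C X for general X is never claimed.
-
Literature.Barriers.HodgeConjecture.BarbieriVialeSrinivas1994_singularLefschetzOneOne_counterexample: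
it sharpens K1's why-might-fail rather than blocking it: Y is ℚ̄-definable and cdh-Tate, its
weight-2 Hodge cycles lie in H²_M (Arapura Thm 7.8) but not in c₁(K₀) — the K₀-vs-KH₀ gap is real
for cuspidal (non-snc, 𝔾_a-type) singularities; evaded in the typed K1 because restricted ambient
classes are c₁ of restricted line bundles (Lefschetz (1,1) on 𝒳), and in the mechanism by the bet
that snc unions of smooth toric varieties (seminormal, multiplicative gluing only) are K-regular
enough in Adams degree p.
- Literature.Barriers.HodgeConjecture.Grothendieck1969_generalHodgeConjecture_false: no
coniveau/level statement is made; the ℚ-structure is used essentially (ℚ-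

History (route lifecycle, newest last):
- 2026-08-16T02:18:46Z · AUTO-CRUX: 1 conjecture-grade item(s) promoted to crux (VariationalHodgeOverCurves) — refuter vetting / tiering apply (operator:999:1362873)
- 2026-08-16T14:43:07Z · LINT AUTOFIX route.multi-assembly: kept Assembly, dropped Assembly2 (gate:hygiene)
- 2026-08-26T16:57:53Z · DORMANT — reconciler: no traction for 5.4 d (last activity item-evidence-added at 2026-08-21T05:52:00Z); parked, not closed — `ledger route dormant route-HodgeConjecture- (operator:999:3235152)

sub-problem: HodgeConjecture · status: dormant · opened planner-plancard-HodgeConjecture-HodgeConject-077d2bd2-0 2026-08-15T13:55:40Z · rev 6 · ledger route-HodgeConjecture-TateCuspKLift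
GENERATED by the gate from the ledger (D-0016/17). Provers cite these decls: `theorem foo : Summit.HodgeConjecture.HodgeConjecture.Theses.TateCuspKLift.<Decl> := …` in Summits/HodgeConjecture/HodgeConjecture/Theorems/<Name>.lean.
-/

namespace Summit.HodgeConjecture.HodgeConjecture.Theses.TateCuspKLift

open scoped BigOperators Topology Manifold Classical MeasureTheory ProbabilityTheory Matrix InnerProductSpace ComplexConjugate ContinuousMap
open Filter Set Function TopologicalSpace MeasureTheory

attribute [summit_statement] _root_.HodgeConjecture

/-- item stmt-HodgeConjecture-9312 · target · rank 0 · open · by planner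
why it might fail: HC-safe. MIS-SCOPED AS TYPED: f is not required dominant — f constant with o ∉ f(𝒳) gives X_o = ∅ (ℚ̄-Tate clause vacuous), so X = 'every absolute Hodge class on every smooth projective variety is algebraic' (5 refuters); needs f surjective ∧ X_o ≠ ∅. Intended scope opens at Weil n ≥ 4.
sources: Arapura2016SingularLefschetz, CharlesSchnell2014Notes, Deligne1982HodgeCycles, FaltingsChai1990, Andre1996Motifs, Markman2025SecantWeil
[target] X as in the Thesis: smooth projective 𝒳 → C over a smooth projective curve, o ∈ C(ℂ) with
ℚ̄-Tate fibre X_o (base change of a ℚ̄-scheme partitioned into finitely many locally closed split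
tori), ξ ∈ H^(2p)(𝒳(ℂ);ℂ) absolute Hodge ⟹ ξ|X_t ∈ algebraicClasses X_t p for every smooth
projective fibre X_t. -/
@[route_item "route-HodgeConjecture-TateCuspKLift"]
def CuspAccessibleHodge : Prop :=
  ∀ (N p : ℕ) (𝒳 C : Literature.AlgebraicGeometry.Motives.SchemeOver ℂ) (f : 𝒳 ⟶ C) (o : Literature.AlgebraicGeometry.Motives.AlgPoints C ℂ), Literature.AlgebraicGeometry.Motives.IsSmoothProjective N 𝒳 → Literature.AlgebraicGeometry.Motives.IsSmoothProjective 1 C → (∃ (X₁ : Literature.AlgebraicGeometry.Motives.SchemeOver (AlgebraicClosure ℚ)) (σ : AlgebraicClosure ℚ →+* ℂ) (_ : Literature.AlgebraicGeometry.Motives.fiberOver f o ≅ (Literature.AlgebraicGeometry.Motives.baseChangeHom σ).obj X₁) (ι : Type) (_ : Finite ι) (b : ι → ℕ) (e : ∀ i : ι, Literature.AlgebraicGeometry.Motives.specOver (AlgebraicClosure ℚ) (AddMonoidAlgebra (AlgebraicClosure ℚ) (Fin (b i) →₀ ℤ)) ⟶ X₁), (∀ i, AlgebraicGeometry.IsImmersion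 (e i).left) ∧ (Pairwise fun i j => Disjoint (Set.range fun x => (e i).left.base x) (Set.range fun x => (e j).left.base x)) ∧ (⋃ i, Set.range fun x => (e i).left.base x) = Set.univ) → ∀ ξ : Literature.AlgebraicGeometry.HodgeTheory.complexBetti 𝒳 (2 * p), Literature.AlgebraicGeometry.HodgeTheory.IsAbsoluteHodgeClass N 𝒳 p ξ → ∀ (t : Literature.AlgebraicGeometry.Motives.AlgPoints C ℂ) (n : ℕ), Literature.AlgebraicGeometry.Motives.IsSmoothProjective n (Literature.AlgebraicGeometry.Motives.fiberOver f t) → (Literature.AlgebraicGeometry.HodgeTheory.complexBetti.map (Literature.AlgebraicGeometry.Motives.fiberι f t) (2 * p)).hom ξ ∈ Literature.AlgebraicGeometry.HodgeTheory.algebraicClasses (Literature.AlgebraicGeometry.Motives.fiberOver f t) p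

/-- item stmt-HodgeConjecture-9313 · crux · rank 2 · open · by planner
why it might fail: Typed form is HC-implied (Y := 𝒳): only the mechanism can die. (G) gives a cdh-MOTIVIC lift (Ext²_MT(F)=0 + Borel on ⊕ places; each Ext¹ step of the weight dévissage must be F-rational); honest K₀ needs K₀⊗ℚ ↠ KH₀⊗ℚ in Adams weight p for snc toric unions: open (CHWW: one toric variety; BVS: p=1).
sources: Arapura2016SingularLefschetz (arXiv:1605.00587 §8: Conj 8.1, Lemma 8.6, Thm 7.8), DeligneGoncharov2005, book:marcolli2009-feynman-motives p90 (Ext¹_MT(F)(ℚ(0),ℚ(n)) = K_{2n-1}(F)⊗ℚ, Ext² = 0; read this session), Borel1977, BarbieriVialeSrinivas1994NS, arXiv:1301.0425 (Anderson–Payne Rem 1.4/5.11: K⁰→KH⁰ split surjective for toric varieties, after CHWW)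
[crux] (card (G)/(M3) and E0 — the arithmetic-cusp theorem-candidate, typed.) For 𝒳, C, f, o as in X
with X_o ℚ̄-Tate and ξ ∈ H^(2p)(𝒳(ℂ);ℂ) absolute Hodge, ξ|X_o lies in PB^p(X_o) := ℂ-span of {g^*a :
g : X_o → Y a ℂ-morphism, Y smooth projective, a ∈ algebraicClasses Y p} ( = ch_p(K₀(X_o) ⊗ ℚ) ⊗ ℂ:
every vector bundle is a Grassmannian pull-back after an ample twist, and conversely g^*cl(Z) =
ch_p(g^*u) with u = ch⁻¹[Z] ∈ K₀(Y)_ℚ by GRR, ch(u) concentrated in degree p; a rational class in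
the ℂ-span of rational vectors lies in their ℚ-span). Intended proof: ξ|X_o ∈ Hom_MHS(ℚ(−p),
H^(2p)(X_o)) (image of a pure weight-2p structure); X_o ≅ X₁ ⊗_σ ℂ with X₁ torus-partitioned over
ℚ̄, hence over a number field F, so M(X₁) ∈ DMT(F); Ext²_MT(F) = 0 gives H^(2p)_M(X₁, ℚ(p)) ↠
Hom_MT(F)(ℚ(−p), h^(2p)(X₁)); Gr^W_(2p)(ξ|X_o) is a ℚ-combination of cycle classes of strata,
canonically defined over F, and the Ext¹_MT-obstruction to lifting it into W_(2p) has vanishing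
Hodge realisation at EVERY complex place τ = σ'σ because the conjugate ξ^σ' is again a Hodge class
restricting to X_o^σ' (absolute Hodge) — Borel injectivity on ⊕_τ for K_(2j−1)(F)_ℚ, j ≥ 2, units at
j = 1, dévissage along the we -/
@[route_item "route-HodgeConjecture-TateCuspKLift", crux]
def ArithmeticTateRestriction : Prop :=
  ∀ (N p : ℕ) (𝒳 C : Literature.AlgebraicGeometry.Motives.SchemeOver ℂ) (f : 𝒳 ⟶ C) (o : Literature.AlgebraicGeometry.Motives.AlgPoints C ℂ), Literature.AlgebraicGeometry.Motives.IsSmoothProjective N 𝒳 → Literature.AlgebraicGeometry.Motives.IsSmoothProjective 1 C → (∃ (X₁ : Literature.AlgebraicGeometry.Motives.SchemeOver (AlgebraicClosure ℚ)) (σ : AlgebraicClosure ℚ →+* ℂ) (_ : Literature.AlgebraicGeometry.Motives.fiberOver f o ≅ (Literature.AlgebraicGeometry.Motives.baseChangeHom σ).obj X₁) (ι : Type) (_ : Finite ι) (b : ι → ℕ) (e : ∀ i : ι, Literature.AlgebraicGeometry.Motives.specOver (AlgebraicClosure ℚ) (AddMonoidAlgebra (AlgebraicClosure ℚ) (Fin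 (b i) →₀ ℤ)) ⟶ X₁), (∀ i, AlgebraicGeometry.IsImmersion (e i).left) ∧ (Pairwise fun i j => Disjoint (Set.range fun x => (e i).left.base x) (Set.range fun x => (e j).left.base x)) ∧ (⋃ i, Set.range fun x => (e i).left.base x) = Set.univ) → ∀ ξ : Literature.AlgebraicGeometry.HodgeTheory.complexBetti 𝒳 (2 * p), Literature.AlgebraicGeometry.HodgeTheory.IsAbsoluteHodgeClass N 𝒳 p ξ → (Literature.AlgebraicGeometry.HodgeTheory.complexBetti.map (Literature.AlgebraicGeometry.Motives.fiberι f o) (2 * p)).hom ξ ∈ Submodule.span ℂ {c : Literature.AlgebraicGeometry.HodgeTheory.complexBetti (Literature.AlgebraicGeometry.Motives.fiberOver f o) (2 * p) | ∃ (m : ℕ) (Y : Literature.AlgebraicGeometry.Motives.SchemeOver ℂ) (_ : Literature.AlgebraicGeometry.Motives.IsSmoothProjective m Y) (g : Literature.AlgebraicGeometry.Motives.fiberOver f o ⟶ Y) (a : Literature.AlgebraicGeometry.HodgeTheory.complexBetti Y (2 * p)), a ∈ Literature.AlgebraicGeometry.HodgeTheory.algebraicClasses Y p ∧ c = (Literature.AlgebraicGeometry.HodgeTheory.complexBetti.map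 g (2 * p)).hom a}

/-- item stmt-HodgeConjecture-9314 · crux · rank 3 · open · by planner
why it might fail: AS TYPED ⟺ HC: f constant through c₀ ≠ o makes X_o = ∅ (PB-hypothesis vacuous) and X_{c₀} ≅ 𝒳 (refuters g40-52/g41-51/g41-42): restate with f surjective ∧ X_o ≠ ∅. Repaired, it still CONTAINS Grothendieck's variational HC over curves (open; only BEK's formal half in print; log-BEK at snc fibres).
sources: BlochEsnaultKerz2014CharZero (arXiv:1310.1773 Thm 2, Conj 4, App. A), book:cattani2014-hodge-theory-princeton-mathematical-notes-49 pp477-480 (Conj 11.3.1 = Grothendieck 1966 fn 13; Cor 11.3.6 HC ⇒ VHC; read this session), Bloch1972Semiregularity, BuchweitzFlenner2003, arXiv:2604.00511, Steenbrink1976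
[crux] (card E4, the sideways step; ANY fibre, no arithmetic.) For f : 𝒳 → C as above and ξ ∈
H^(2p)(𝒳(ℂ);ℂ) rational of Hodge type (p,p): if ξ|X_o ∈ PB^p(X_o) — i.e. ξ|X_o = ch_p(v) for some v
∈ K₀(X_o) ⊗ ℚ with ch(v) concentrated in degree p — then ξ|X_t is algebraic on every smooth
projective fibre X_t. Mechanism: represent v by perfect complexes on X_o, deform over the formal/log
germ of C at o (log Bloch–Esnault–Kerz: the obstruction is the Hodge obstruction, which vanishes
because ξ is globally of type (p,p)), algebraize (𝒳 is projective over C), read off ch_p = ξ|X_t for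
t near o, spread along C (countably many relative Chow components, one dominates). Contains
Grothendieck's variational Hodge conjecture over curves (support VariationalHodgeOverCurves = the
case X_o smooth; KClassPropagates → it is proved in Sketch.lean). [deps: ArithmeticTateRestriction]
[difficulty: open-problem] -/
@[route_item "route-HodgeConjecture-TateCuspKLift", crux]
def KClassPropagates : Prop :=
  ∀ (N p : ℕ) (𝒳 C : Literature.AlgebraicGeometry.Motives.SchemeOver ℂ) (f : 𝒳 ⟶ C) (o : Literature.AlgebraicGeometry.Motives.AlgPoints C ℂ), Literature.AlgebraicGeometry.Motives.IsSmoothProjective N 𝒳 → Literature.AlgebraicGeometry.Motives.IsSmoothProjective 1 C → ∀ ξ : Literature.AlgebraicGeometry.HodgeTheory.complexBetti 𝒳 (2 * p), Literature.AlgebraicGeometry.HodgeTheory.IsRationalClass ξ → Literature.AlgebraicGeometry.HodgeTheory.IsOfHodgeType N 𝒳 (2 * p) p p ξ → (Literature.AlgebraicGeometry.HodgeTheory.complexBetti.map (Literature.AlgebraicGeometry.Motives.fiberι f o) (2 * p)).hom ξ ∈ Submodule.span ℂ {c : Literature.AlgebraicGeometry.HodgeTheory.complexBetti (Literature.AlgebraicGeometry.Motives.fiberOver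 f o) (2 * p) | ∃ (m : ℕ) (Y : Literature.AlgebraicGeometry.Motives.SchemeOver ℂ) (_ : Literature.AlgebraicGeometry.Motives.IsSmoothProjective m Y) (g : Literature.AlgebraicGeometry.Motives.fiberOver f o ⟶ Y) (a : Literature.AlgebraicGeometry.HodgeTheory.complexBetti Y (2 * p)), a ∈ Literature.AlgebraicGeometry.HodgeTheory.algebraicClasses Y p ∧ c = (Literature.AlgebraicGeometry.HodgeTheory.complexBetti.map g (2 * p)).hom a} → ∀ (t : Literature.AlgebraicGeometry.Motives.AlgPoints C ℂ) (n : ℕ), Literature.AlgebraicGeometry.Motives.IsSmoothProjective n (Literature.AlgebraicGeometry.Motives.fiberOver f t) → (Literature.AlgebraicGeometry.HodgeTheory.complexBetti.map (Literature.AlgebraicGeometry.Motives.fiberι f t) (2 * p)).hom ξ ∈ Literature.AlgebraicGeometry.HodgeTheory.algebraicClasses (Literature.AlgebraicGeometry.Motives.fiberOver f t) p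

-- item stmt-HodgeConjecture-9609 · crux · rank 5 · open · by planner — informal only, no Lean statement yet:
--   [crux, NEGATIVE SIDE = card E2 'K2-Bloch example'] There exist a projective snc variety X0 over C
--   (not over Qbar!) all of whose closed strata are smooth projective TORIC varieties glued along
--   torus-invariant strata by monomial maps with transcendental gluing parameters, with H^3 of the dual
--   complex Γ nonzero, and a weight-2p Hodge cycle β in Hom_MHS(Q(-p), H^{2p}(X0,Q)) (p >= 2) which is
--   NOT in the image of cdh-motivic cohomology H^{2p}_M(X0,Q(p)) -> H^{2p}(X0,Q(p)) — witnessed by a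
--   nonzero 'Milnor flux' d_3(β) in K_2(C)_Q ⊗ H^3(CH^{p-2}(X^{[•]})-cochains) (a sum of Steinberg
--   symbols {s_a, s_b

/-- item stmt-HodgeConjecture-9315 · crux (kind.auto-crux: conjecture-grade) · rank 9 · open · by planner
why it might fail: auto-crux — conjecture-grade statement (docstring avows it ('Open problem')); it is open, so it may simply be false
sources: BlochEsnaultKerz2014CharZero, Bloch1972Semiregularity
[support] the smooth-special-fibre case of KClassPropagates = Grothendieck's variational Hodge
conjecture in global-class form over a projective curve: ξ rational of type (p,p) on a smooth
projective 𝒳 → C, ξ|X_o algebraic on ONE smooth projective fibre X_o ⟹ ξ|X_t algebraic on every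
smooth projective fibre. Filed to make the containment explicit (KClassPropagates →
VariationalHodgeOverCurves, three lines in Sketch.lean: an algebraic class on a smooth projective
fibre is a pulled-back algebraic class along the identity) and as the meeting point with route
AnchorTransport's VariationalHodge (smooth families over an arbitrary smooth base, total space not
compactified). Open problem in general (known for p = 1 and in BEK's formal form). [difficulty:
open-problem] -/
@[route_item "route-HodgeConjecture-TateCuspKLift"]
def VariationalHodgeOverCurves : Prop :=
  ∀ (N p : ℕ) (𝒳 C : Literature.AlgebraicGeometry.Motives.SchemeOver ℂ) (f : 𝒳 ⟶ C) (o : Literature.AlgebraicGeometry.Motives.AlgPoints C ℂ), Literature.AlgebraicGeometry.Motives.IsSmoothProjective N 𝒳 → Literature.AlgebraicGeometry.Motives.IsSmoothProjective 1 C → ∀ ξ : Literature.AlgebraicGeometry.HodgeTheory.complexBetti 𝒳 (2 * p), Literature.AlgebraicGeometry.HodgeTheory.IsRationalClass ξ → Literature.AlgebraicGeometry.HodgeTheory.IsOfHodgeType N 𝒳 (2 * p) p p ξ → ∀ n₀ : ℕ, Literature.AlgebraicGeometry.Motives.IsSmoothProjective n₀ (Literature.AlgebraicGeometry.Motives.fiberOver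 f o) → (Literature.AlgebraicGeometry.HodgeTheory.complexBetti.map (Literature.AlgebraicGeometry.Motives.fiberι f o) (2 * p)).hom ξ ∈ Literature.AlgebraicGeometry.HodgeTheory.algebraicClasses (Literature.AlgebraicGeometry.Motives.fiberOver f o) p → ∀ (t : Literature.AlgebraicGeometry.Motives.AlgPoints C ℂ) (n : ℕ), Literature.AlgebraicGeometry.Motives.IsSmoothProjective n (Literature.AlgebraicGeometry.Motives.fiberOver f t) → (Literature.AlgebraicGeometry.HodgeTheory.complexBetti.map (Literature.AlgebraicGeometry.Motives.fiberι f t) (2 * p)).hom ξ ∈ Literature.AlgebraicGeometry.HodgeTheory.algebraicClasses (Literature.AlgebraicGeometry.Motives.fiberOver f t) p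

/-- item stmt-HodgeConjecture-9316 · support · rank 9 · closed · proved by Summit.HodgeConjecture.HodgeConjecture.Theorems.tateCuspKLift_engineGlue_proof @ cebd89d6db01 (prover) · by planner
sources: Arapura2016SingularLefschetz, BlochEsnaultKerz2014CharZero
[support] the engine composes by pure logic: ArithmeticTateRestriction → KClassPropagates →
CuspAccessibleHodge (an absolute Hodge class is rational and of type (p,p); K1 supplies the
PB-membership that K2 consumes). Proved sorry-free in Sketch.lean (`engineGlue_holds`, axioms
propext / Classical.choice / Quot.sound); filed so that a prover can land it at once and the route's
internal logic is on the ledger. [difficulty: provable-now] -/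
@[route_item "route-HodgeConjecture-TateCuspKLift", crux]
def EngineGlue : Prop :=
  ArithmeticTateRestriction → KClassPropagates → CuspAccessibleHodge

-- `EngineGlue` holds: proved by `Summit.HodgeConjecture.HodgeConjecture.Theorems.tateCuspKLift_engineGlue_proof` @ cebd89d6db01 (its module imports this route file, so no `_holds` link can be stated here).

-- item stmt-HodgeConjecture-9610 · support · rank 9 · open · by planner — informal only, no Lean statement yet:
--   [support = card E1, definition-level] For a projective semistable degeneration XX -> (C, o) with snc
--   fibre X0 = ∪ X_i and a flat rational (p,p)-class α (a Hodge class ξ on XX), the 'flux' of the limit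
--   — the class of the first non-vanishing higher differential d_r(z_0) (r >= 2) of the closed-cover/cdh
--   descent spectral sequence E_1^{a,b} = CH^p(X^{[a]}, 2p-b)_Q => H^{2p}_M(X0, Q(p)) applied to
--   componentwise cycle data z_0 in ⊕ CH^p(X_i)_Q lifting Gr^W_{2p}(ξ|X0) — is independent, modulo the
--   natural indeterminacy (restrictions of CH^p(X_i)_hom, the c_1(normal bundle)-ideal on double loci,
--   images

-- item stmt-HodgeConjecture-9611 · support · rank 9 · open · by planner — informal only, no Lean statement yet:
--   [support = card E3, kit-sized computation once FluxWellDefined's dictionary is explicit] At a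
--   2-parameter (boundary stratum of dimension >= 2) totally degenerate cusp of the Weil locus of
--   abelian 2n-folds of Weil type on a hyperbolic component, with boundary-torus coordinates s_1, s_2
--   and Zharkov's explicit tropical Weil classes w_1, w_2 (Zharkov2020TropicalWeil) as the limit data,
--   compute the rational antisymmetric 'symbol matrix' (c_ab) of the K_2-flux Σ_{a<b} c_ab {s_a, s_b} +
--   Σ_a {s_a, γ_a} from the dual complex Γ = (S^1)^{2n}, the weights of w_i and the monomial gluing data
--   (finitely many

-- item stmt-HodgeConjecture-9612 · support · rank 9 · open · by planner — informal only, no Lean statement yet: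
--   [support, the K_0-vs-KH_0 step isolated from ArithmeticTateRestriction] For a projective snc variety
--   X0 over a field of characteristic 0 whose closed strata are smooth projective toric varieties (more
--   generally: affinely paved), the natural map K_0(X0) ⊗ Q -> KH_0(X0) ⊗ Q is surjective onto the Adams
--   eigenspace of weight p for every p (equivalently onto H^{2p}_cdh(X0, Q(p))); a fortiori every class
--   in the image of H^{2p}_M(X0,Q(p)) -> H^{2p}(X0(C),Q) is ch_p of an honest vector-bundle class, i.e.
--   lies in PB^p(X0). Evidence: for a TORIC variety (fan, any field) K^0(X) -> KH_0(X) is SPLIT SURJEC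

/-- item stmt-HodgeConjecture-9317 · assembly · rank 1 · open · by planner
sources: Deligne2000, Arapura2016SingularLefschetz
[assembly] the summit frame X → HodgeConjecture (scope complement: HC for classes that are not
cusp-accessible; implied by HC; not claimed by the mechanism; used by `closes` together with
EngineGlue). -/
@[route_item "route-HodgeConjecture-TateCuspKLift", crux]
def Assembly : Prop :=
  CuspAccessibleHodge → _root_.HodgeConjecture

-- records of items no longer active in this route (dropped / restated):
-- earlier Assembly2 (stmt-HodgeConjecture-9608, dropped 2026-08-16T14:43:07Z): moot by None — [crux] (card (M3) CONSEQUENCE + assembly input; Weil sector.) For every abelian 2n-fold of Weil type (A, K = Q(sqrt -d), phi with phi >> phi = -d, n >= 2) whose van Geemen hermitian form H on H_1(A,Q) is HYPERBOLIC (disc H = (-1)^n in Q*/Nm(K*), equivalently Witt index n, equivalently the Weil-locus compone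

/-! D-0027 §2.1 — DECIDING THEOREM (planner-authored via `route open/edit --closes-file`; by planner-rrepair-HodgeConjecture-TateCuspKLift-3612919f-0 2026-08-15T20:55:22Z):
its hypotheses are this route's items and its conclusion the sub-problem Statement (glue_lint), and it elaborates with this file. -/

@[closes "route-HodgeConjecture-TateCuspKLift"] theorem closes (h₁ : Assembly) (h₂ : ArithmeticTateRestriction) (h₃ : KClassPropagates) (h₅ : EngineGlue) : _root_.HodgeConjecture :=
  h₁ (h₅ h₂ h₃)

end Summit.HodgeConjecture.HodgeConjecture.Theses.TateCuspKLift
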